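import Summits.BirchSwinnertonDyer.BirchSwinnertonDyer.Theorems.SignedLowerHalvesSmallImageLowerHalfBothSignsRttCharRoadE1InjTopDesc
import Summits.BirchSwinnertonDyer.BirchSwinnertonDyer.Theorems.SignedLowerHalvesSmallImageLowerHalfBothSignsRttCharRoadE1InjectivityCore
import Summits.BirchSwinnertonDyer.BirchSwinnertonDyer.Theorems.SignedLowerHalvesSmallImageLowerHalfBothSignsRttCharRoadE1CoefficientEntry
import HarnessLib

/-!
# Route `SignedLowerHalves`, crux L `SmallImageLowerHalfBothSigns` (stmt-BirchSwinnertonDyer-23599), line `rtt_w3` v12 — glue `charRoad_injTop`,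
# LEAD: block I AT LEVEL `∞` — the injectivity core of `injTop_of_inputs`

WHY: in the composition (INPUT SPEC, bus 2026-08-30) a coordinate pair of a class is `(cor_∞ E_∞[ψ], cor_∞ E_∞[ψ'])` with `ψ` a `W_K[p^∞]`-valued
cocycle on `Γ_{K_∞}` killed by `p` (values `s_l(φ)` on `M[π]`) and `ψ' = û ∘ ψ` (the twisted coordinate). This file proves: both vanish ⇒ `[ψ] = 0`.
Route (memo §2): transport to `Γ_{ℚ_∞}`-side classes on `N_∞ = Γ_{K_∞}` (one `resH1Hom`), LIFT the `p`-torsion-valued cocycle to `W[p]`-coefficients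
(`exists_cocycle_comp`, D3-b), identify the twist with -w3's `u` on `W[p]` through the BRIDGE `û ∘ pBCE ∘ incl = pBCE ∘ incl ∘ u`, kill the `W[p]`-class by
-w3 g17's `eq_zero_of_corH1_eq_zero_of_corH1_pushH1_eq_zero` (cor-pair injectivity for `(u, v)`, p766491) after moving `cor` across `incl_*` (p767726) and using
`incl_*` injective on `H¹(ℚ_∞, ·)` (`W(ℚ_∞)[p^∞] = 0`, p767920), and come back (`E_∞` is injective: `e_∞` has a section, `subgroupH1Iso` is an iso, `res_=` is an iso).

WHAT: `corH1_pair_lift_eq_zero` (on `N_∞`-cocycles), `injective_resH1Hom_subgroupH1Iso_resOfLe_infty` (`E_∞` injective), ★★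
`oneCocycleClass_eq_zero_of_corH1_infty_pair_eq_zero`. THEOREMS ONLY; no `k`-structure here: `u, v` enter through four equations (`galRange`-equivariance,
anti-commutation with the shared local transversal `c`, `v ∘ u = id`) that -w3's p767784 `exists_kStructure_endomorphism_coords` supplies.
[cite: SerreGaloisCohomology1997, I §2.4, I §5.8] [cite: NeukirchSchmidtWingberg2008, (1.5.7), (1.6.3)] [cite: GreenbergLNM1716, §4 p. 109]
-/

set_option linter.dupNamespace false -- D-0017: single-problem summit, the namespace repeats the problem name by design

noncomputable section

open scoped Classical

namespace Summit.BirchSwinnertonDyer.BirchSwinnertonDyer.Theorems.SmallImageCharSignedSelmer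

open NumberField IsDedekindDomain Field Literature.NumberTheory.EllipticCurves Literature.NumberTheory.GaloisRepresentations
  Summit.BirchSwinnertonDyer.Rank1Residual.Additive.LocalTransport Summit.BirchSwinnertonDyer.Rank1Residual.Additive.BaseChange
  WeierstrassCurve

section Core

variable (K : Type) [Field K] [NumberField K] (hK2 : Module.finrank ℚ K = 2) {p : ℕ} [hp : Fact p.Prime] (hp2 : p ≠ 2)
  (κ : ZpExtension ℚ p) (W : WeierstrassCurve ℚ) [W.IsElliptic] (hirr : W.HasIrreducibleModPGaloisRep p)
  (v₀ : HeightOneSpectrum (𝓞 ℚ)) (ι : AlgebraicClosure ℚ →ₐ[ℚ] AlgebraicClosure (v₀.adicCompletion ℚ))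
  [((galRange (K := ℚ) K).subgroupOf κ.kerSubgroup).Normal]
  {c : absoluteGaloisGroup (v₀.adicCompletion ℚ)} (hc : c ∈ localSubgroupOfEmb κ.kerSubgroup ι) (hcU : resGalOfEmb ι c ∉ galRange (K := ℚ) K)
  (hNinf : IsOpen (((galRange (K := ℚ) K).subgroupOf κ.kerSubgroup : Subgroup κ.kerSubgroup) : Set κ.kerSubgroup))
  (hMinf : ∀ m : W.geomPrimaryTorsion p, Continuous fun g : κ.kerSubgroup ↦ g • m)
  (hMpinf : ∀ m : geomTorsion W p, Continuous fun g : κ.kerSubgroup ↦ g • m)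
  (û : (W.baseChange K).geomPrimaryTorsion p →+ (W.baseChange K).geomPrimaryTorsion p) (u v : geomTorsion W p →+ geomTorsion W p)
  (hu : ∀ τ : absoluteGaloisGroup ℚ, τ ∈ galRange (K := ℚ) K → ∀ m : geomTorsion W p, u (τ • m) = τ • u m)
  (hv : ∀ τ : absoluteGaloisGroup ℚ, τ ∈ galRange (K := ℚ) K → ∀ m : geomTorsion W p, v (τ • m) = τ • v m)
  (hcu : ∀ m : geomTorsion W p, u (resGalOfEmb ι c • m) = -(resGalOfEmb ι c • u m)) (hvu : ∀ m : geomTorsion W p, v (u m) = m)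
  (hbridge : ∀ a : geomTorsion W p,
    û (primaryBaseChangeEquiv K W p (AddSubgroup.inclusion (W.geomTorsion_le_geomPrimaryTorsion p) a)) =
      primaryBaseChangeEquiv K W p (AddSubgroup.inclusion (W.geomTorsion_le_geomPrimaryTorsion p) (u a)))

include hp2 hirr hMpinf hu hv hcu hvu hbridge in
/-- **Lift-and-kill on `N_∞`.** For cocycles `Ξ, Ξ'` of `N_∞ = Γ_{K_∞}` (inside `Γ_{ℚ_∞}`) with values in `W[p^∞]`, `Ξ` killed by `p` pointwise and
`Ξ' = pBCE⁻¹ ∘ û ∘ pBCE ∘ Ξ`: if `cor_∞ [Ξ] = 0` and `cor_∞ [Ξ'] = 0` then `[Ξ] = 0` — lift `Ξ` to `W[p]` (D3-b), identify the twist with `u` (bridge), apply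
g17's pair injectivity (p766491) after p767726/p767920. [cite: SerreGaloisCohomology1997, I §2.4, I §5.8] [cite: NeukirchSchmidtWingberg2008, (1.5.7)] -/
theorem corH1_pair_lift_eq_zero
    (Ξ Ξ' : contOneCocycles (discreteTopRep ((galRange (K := ℚ) K).subgroupOf κ.kerSubgroup) (W.geomPrimaryTorsion p)))
    (hΞp : ∀ x, p • Ξ.1 x = 0)
    (hΞ' : ∀ x, Ξ'.1 x = (primaryBaseChangeEquiv K W p).symm (û (primaryBaseChangeEquiv K W p (Ξ.1 x))))
    (h1 : corH1 hNinf hMinf (xor_mem_subgroupOf_of_index_two κ.kerSubgroup (galRange (K := ℚ) K) ι (index_galRange_eq_two K hK2) hc hcU)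
      (oneCocycleClass _ Ξ) = 0)
    (h2 : corH1 hNinf hMinf (xor_mem_subgroupOf_of_index_two κ.kerSubgroup (galRange (K := ℚ) K) ι (index_galRange_eq_two K hK2) hc hcU)
      (oneCocycleClass _ Ξ') = 0) :
    oneCocycleClass _ Ξ = 0 := by
  -- bookkeeping on `W[p] ↪ W[p^∞]`
  have hinclT : ∀ (g : κ.kerSubgroup) (a : geomTorsion W p), AddSubgroup.inclusion (W.geomTorsion_le_geomPrimaryTorsion p) (g • a) =
      g • AddSubgroup.inclusion (W.geomTorsion_le_geomPrimaryTorsion p) a := fun g a ↦ inclusion_geomTorsion_smul (g : absoluteGaloisGroup ℚ) a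
  have hpA : ∀ a : geomTorsion W p, p • a = 0 := fun a ↦ Subtype.ext (by
    rw [AddSubgroupClass.coe_nsmul, ZeroMemClass.coe_zero, ← natCast_zsmul]
    exact (WeierstrassCurve.mem_torsionPoints_iff _ _ (a : geomPoints W)).mp a.2)
  have hH0 : ∀ m : W.geomPrimaryTorsion p, (∀ x : κ.kerSubgroup, x • m = m) → m = 0 := fun m hm ↦ by
    have h := Summit.BirchSwinnertonDyer.Rank1Residual.GaloisImage.fixedPoints_kerSubgroup_eq_bot_of_irreducible W p hirr κ
    have hm' : m ∈ FixedPoints.addSubgroup κ.kerSubgroup (W.geomPrimaryTorsion p) := by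
      rw [FixedPoints.mem_addSubgroup]; exact fun x ↦ hm x
    rw [h] at hm'
    exact (AddSubgroup.mem_bot).1 hm'
  have hinjI : Function.Injective (resH1Hom (ContinuousMonoidHom.id κ.kerSubgroup) (AddSubgroup.inclusion (W.geomTorsion_le_geomPrimaryTorsion p))
      (fun x a ↦ inclusion_geomTorsion_smul (W := W) (p := p) (x : absoluteGaloisGroup ℚ) a)) :=
    resH1Hom_id_injective_of_torsionBy (G := absoluteGaloisGroup ℚ) (H := κ.kerSubgroup) _ (inclusion_geomTorsion_smul (W := W) (p := p))
      (AddSubgroup.inclusion_injective _) p hpA (mem_range_inclusion_of_nsmul_eq_zero (W := W) (p := p)) hH0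
  -- the `N_∞`-module maps `u`, `v` and the transversal
  have hu' : ∀ (x : (galRange (K := ℚ) K).subgroupOf κ.kerSubgroup) (m : geomTorsion W p), u (x • m) = x • u m := fun x m ↦ by
    rw [Subgroup.smul_def, Subgroup.smul_def, Subgroup.smul_def, Subgroup.smul_def]
    exact hu _ (Subgroup.mem_subgroupOf.1 x.2) m
  have hv' : ∀ (x : (galRange (K := ℚ) K).subgroupOf κ.kerSubgroup) (m : geomTorsion W p), v (x • m) = x • v m := fun x m ↦ by
    rw [Subgroup.smul_def, Subgroup.smul_def, Subgroup.smul_def, Subgroup.smul_def]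
    exact hv _ (Subgroup.mem_subgroupOf.1 x.2) m
  have hcu' : ∀ m : geomTorsion W p, u (resGalSubgroupOfEmb κ.kerSubgroup ι ⟨c, hc⟩ • m) = -(resGalSubgroupOfEmb κ.kerSubgroup ι ⟨c, hc⟩ • u m) :=
    fun m ↦ by rw [Subgroup.smul_def, Subgroup.smul_def, resGalSubgroupOfEmb_apply_coe]; exact hcu m
  -- LIFT `Ξ` to `W[p]`-coefficients
  set S : AddSubgroup (W.geomPrimaryTorsion p) := (W.geomTorsion p).addSubgroupOf (W.geomPrimaryTorsion p) with hSdef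
  have hS : ∀ (x : (galRange (K := ℚ) K).subgroupOf κ.kerSubgroup) (m : W.geomPrimaryTorsion p), m ∈ S → (x : κ.kerSubgroup) • m ∈ S := by
    intro x m hm
    rw [hSdef, AddSubgroup.mem_addSubgroupOf] at hm ⊢
    exact ((((x : κ.kerSubgroup) : absoluteGaloisGroup ℚ)) • (⟨(m : W.geomPoints), hm⟩ : geomTorsion W p)).2
  set ιS : S →+ geomTorsion W p := (AddSubgroup.addSubgroupOfEquivOfLe (W.geomTorsion_le_geomPrimaryTorsion p)).toAddMonoidHom with hιSdef
  have hιS : ∀ (x : (galRange (K := ℚ) K).subgroupOf κ.kerSubgroup) (m : S),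
      ιS ⟨(x : κ.kerSubgroup) • (m : W.geomPrimaryTorsion p), hS x m m.2⟩ = (x : κ.kerSubgroup) • ιS m := fun x m ↦ Subtype.ext rfl
  have hinclιS : ∀ m : S, AddSubgroup.inclusion (W.geomTorsion_le_geomPrimaryTorsion p) (ιS m) = (m : W.geomPrimaryTorsion p) :=
    fun m ↦ Subtype.ext rfl
  have hΞS : ∀ x, Ξ.1 x ∈ S := fun x ↦ by
    obtain ⟨a, ha⟩ := mem_range_inclusion_of_nsmul_eq_zero (Ξ.1 x) (hΞp x)
    rw [hSdef, AddSubgroup.mem_addSubgroupOf, ← ha]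
    exact a.2
  obtain ⟨ζ, hζ⟩ := exists_cocycle_comp S hS ιS hιS Ξ hΞS
  -- `incl_* [ζ] = [Ξ]` and `incl_* (u_* [ζ]) = [Ξ']`
  have hincl : resH1Hom (ContinuousMonoidHom.id _) (AddSubgroup.inclusion (W.geomTorsion_le_geomPrimaryTorsion p))
      (map_subgroup_smul (AddSubgroup.inclusion (W.geomTorsion_le_geomPrimaryTorsion p)) hinclT) (oneCocycleClass _ ζ) = oneCocycleClass _ Ξ := by
    rw [resH1Hom_oneCocycleClass]
    congr 1
    apply Subtype.ext
    apply ContinuousMap.ext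
    intro x
    change AddSubgroup.inclusion (W.geomTorsion_le_geomPrimaryTorsion p) (ζ.1 x) = Ξ.1 x
    rw [hζ, hinclιS]
  have hincl' : resH1Hom (ContinuousMonoidHom.id _) (AddSubgroup.inclusion (W.geomTorsion_le_geomPrimaryTorsion p))
      (map_subgroup_smul (AddSubgroup.inclusion (W.geomTorsion_le_geomPrimaryTorsion p)) hinclT)
      (resH1Hom (ContinuousMonoidHom.id _) u hu' (oneCocycleClass _ ζ)) = oneCocycleClass _ Ξ' := by
    rw [resH1Hom_oneCocycleClass, resH1Hom_oneCocycleClass]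
    congr 1
    apply Subtype.ext
    apply ContinuousMap.ext
    intro x
    change AddSubgroup.inclusion (W.geomTorsion_le_geomPrimaryTorsion p) (u (ζ.1 x)) = Ξ'.1 x
    have ha : Ξ.1 x = AddSubgroup.inclusion (W.geomTorsion_le_geomPrimaryTorsion p) (ιS ⟨Ξ.1 x, hΞS x⟩) := (hinclιS ⟨Ξ.1 x, hΞS x⟩).symm
    rw [hΞ', hζ]
    conv_rhs => rw [ha, hbridge, AddEquiv.symm_apply_apply]
  -- the `W[p]`-valued cor-pair vanishes
  have h1' : corH1 hNinf hMpinf (xor_mem_subgroupOf_of_index_two κ.kerSubgroup (galRange (K := ℚ) K) ι (index_galRange_eq_two K hK2) hc hcU)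
      (oneCocycleClass _ ζ) = 0 := by
    apply hinjI
    rw [map_zero, resH1Hom_corH1_comm hNinf hMpinf hMinf _ _ hinclT, hincl]
    exact h1
  have h2' : corH1 hNinf hMpinf (xor_mem_subgroupOf_of_index_two κ.kerSubgroup (galRange (K := ℚ) K) ι (index_galRange_eq_two K hK2) hc hcU)
      (resH1Hom (ContinuousMonoidHom.id _) u hu' (oneCocycleClass _ ζ)) = 0 := by
    apply hinjI
    rw [map_zero, resH1Hom_corH1_comm hNinf hMpinf hMinf _ _ hinclT, hincl']
    exact h2
  have hζ0 := eq_zero_of_corH1_eq_zero_of_corH1_pushH1_eq_zero hNinf hMpinf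
    (xor_mem_subgroupOf_of_index_two κ.kerSubgroup (galRange (K := ℚ) K) ι (index_galRange_eq_two K hK2) hc hcU) hp.out hp2 hpA u v hu' hv'
    hcu' hvu (oneCocycleClass _ ζ) h1' h2'
  rw [← hincl, hζ0, map_zero]

variable (einf : ((galRange (K := ℚ) K).subgroupOf κ.kerSubgroup) →ₜ* (κ.kerSubgroup ⊓ galRange (K := ℚ) K : Subgroup (absoluteGaloisGroup ℚ)))
  (heinf : ∀ x : (galRange (K := ℚ) K).subgroupOf κ.kerSubgroup,
    ((einf x : (κ.kerSubgroup ⊓ galRange (K := ℚ) K : Subgroup (absoluteGaloisGroup ℚ))) : absoluteGaloisGroup ℚ) =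
      ((x : κ.kerSubgroup) : absoluteGaloisGroup ℚ))
  (einf' : (κ.kerSubgroup ⊓ galRange (K := ℚ) K : Subgroup (absoluteGaloisGroup ℚ)) →ₜ* ((galRange (K := ℚ) K).subgroupOf κ.kerSubgroup))
  (heinf' : ∀ x, einf (einf' x) = x)

omit [W.IsElliptic] [((galRange (K := ℚ) K).subgroupOf κ.kerSubgroup).Normal] in
include heinf heinf' in
/-- **`E_∞ = e_∞^* ∘ subgroupH1Iso ∘ res_=` is injective**: `e_∞` has the section `e_∞'`, `subgroupH1Iso` is an isomorphism, `res` along an equality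
of subgroups is an isomorphism. [cite: SerreGaloisCohomology1997, I §2.4] -/
theorem injective_resH1Hom_subgroupH1Iso_resOfLe_infty :
    Function.Injective fun X : (W.baseChange K).subgroupH1 p (κ.restrictOfFinrankEqTwo hp2 K hK2).kerSubgroup ↦
      resH1Hom einf (AddMonoidHom.id (W.geomPrimaryTorsion p)) (smul_eq_smul_of_coe_eq W p κ.kerSubgroup (galRange (K := ℚ) K) einf heinf)
        (subgroupH1Iso K W p (inf_le_right : κ.kerSubgroup ⊓ galRange (K := ℚ) K ≤ galRange (K := ℚ) K)
          ((W.baseChange K).resOfLe p (le_of_eq (comapResGal_kerSubgroup_inf_galRange hp2 κ K hK2)) X)) := by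
  have hsm' : ∀ (x : (κ.kerSubgroup ⊓ galRange (K := ℚ) K : Subgroup (absoluteGaloisGroup ℚ))) (m : W.geomPrimaryTorsion p),
      AddMonoidHom.id (W.geomPrimaryTorsion p) (einf' x • m) = x • AddMonoidHom.id (W.geomPrimaryTorsion p) m := fun x m ↦ by
    rw [AddMonoidHom.id_apply, AddMonoidHom.id_apply, Subgroup.smul_def, Subgroup.smul_def, Subgroup.smul_def, ← heinf (einf' x), heinf']
  have h1 : Function.Injective (resH1Hom einf (AddMonoidHom.id (W.geomPrimaryTorsion p))
      (smul_eq_smul_of_coe_eq W p κ.kerSubgroup (galRange (K := ℚ) K) einf heinf)) := by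
    intro x y hxy
    have h := congrArg (resH1Hom einf' (AddMonoidHom.id (W.geomPrimaryTorsion p)) hsm') hxy
    simp only [resH1Hom_resH1Hom] at h
    rwa [resH1Hom_congr (φ := einf.comp einf') (φ' := ContinuousMonoidHom.id _)
      (ψ := (AddMonoidHom.id (W.geomPrimaryTorsion p)).comp (AddMonoidHom.id (W.geomPrimaryTorsion p))) (ψ' := AddMonoidHom.id _)
      (ContinuousMonoidHom.ext fun z ↦ heinf' z) (AddMonoidHom.ext fun _ ↦ rfl) _ (fun _ _ ↦ rfl), resH1Hom_id] at h
  have h3 : Function.Injective ((W.baseChange K).resOfLe p (le_of_eq (comapResGal_kerSubgroup_inf_galRange hp2 κ K hK2))) := by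
    intro x y hxy
    have h := congrArg ((W.baseChange K).resOfLe p (le_of_eq (comapResGal_kerSubgroup_inf_galRange hp2 κ K hK2).symm)) hxy
    rw [WeierstrassCurve.resOfLe, WeierstrassCurve.resOfLe, ← AddMonoidHom.comp_apply, ← AddMonoidHom.comp_apply (resOfLe _ _),
      Literature.NumberTheory.EllipticCurves.resOfLe_comp_holds, Literature.NumberTheory.EllipticCurves.resOfLe_refl_holds] at h
    exact h
  intro x y hxy
  exact h3 ((subgroupH1Iso K W p _).injective (h1 hxy))

include hp2 hirr hMpinf hu hv hcu hvu hbridge heinf heinf' in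
/-- ★★ **Block I at level `∞`.** For a cocycle `ψ` of `Γ_{K_∞}` with values in `W_K[p^∞]` killed by `p` pointwise and its twist `ψ' = û ∘ ψ`: if the classes
`cor_∞ (E_∞ [ψ])` and `cor_∞ (E_∞ [ψ'])` both vanish in `H¹(ℚ_∞, W[p^∞])`, then `[ψ] = 0` in `H¹(K_∞, W_K[p^∞])`.
[cite: SerreGaloisCohomology1997, I §2.4, I §5.8] [cite: NeukirchSchmidtWingberg2008, (1.5.7), (1.6.3)] [cite: GreenbergLNM1716, §4 p. 109] -/
theorem oneCocycleClass_eq_zero_of_corH1_infty_pair_eq_zero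
    (ψ ψ' : contOneCocycles (discreteTopRep (κ.restrictOfFinrankEqTwo hp2 K hK2).kerSubgroup ((W.baseChange K).geomPrimaryTorsion p)))
    (hψp : ∀ x, p • ψ.1 x = 0) (hψ' : ∀ x, ψ'.1 x = û (ψ.1 x))
    (h1 : corH1 hNinf hMinf (xor_mem_subgroupOf_of_index_two κ.kerSubgroup (galRange (K := ℚ) K) ι (index_galRange_eq_two K hK2) hc hcU)
      (resH1Hom einf (AddMonoidHom.id (W.geomPrimaryTorsion p)) (smul_eq_smul_of_coe_eq W p κ.kerSubgroup (galRange (K := ℚ) K) einf heinf)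
        (subgroupH1Iso K W p (inf_le_right : κ.kerSubgroup ⊓ galRange (K := ℚ) K ≤ galRange (K := ℚ) K)
          ((W.baseChange K).resOfLe p (le_of_eq (comapResGal_kerSubgroup_inf_galRange hp2 κ K hK2)) (oneCocycleClass _ ψ)))) = 0)
    (h2 : corH1 hNinf hMinf (xor_mem_subgroupOf_of_index_two κ.kerSubgroup (galRange (K := ℚ) K) ι (index_galRange_eq_two K hK2) hc hcU)
      (resH1Hom einf (AddMonoidHom.id (W.geomPrimaryTorsion p)) (smul_eq_smul_of_coe_eq W p κ.kerSubgroup (galRange (K := ℚ) K) einf heinf)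
        (subgroupH1Iso K W p (inf_le_right : κ.kerSubgroup ⊓ galRange (K := ℚ) K ≤ galRange (K := ℚ) K)
          ((W.baseChange K).resOfLe p (le_of_eq (comapResGal_kerSubgroup_inf_galRange hp2 κ K hK2)) (oneCocycleClass _ ψ')))) = 0) :
    oneCocycleClass _ ψ = 0 := by
  apply injective_resH1Hom_subgroupH1Iso_resOfLe_infty K hK2 hp2 κ W einf heinf einf' heinf'
  dsimp only
  rw [map_zero, map_zero, map_zero]
  rw [subgroupH1Iso_apply, WeierstrassCurve.resOfLe, Literature.NumberTheory.EllipticCurves.resOfLe, resH1Hom_resH1Hom, resH1Hom_resH1Hom,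
    resH1Hom_oneCocycleClass] at h1 h2 ⊢
  refine corH1_pair_lift_eq_zero K hK2 hp2 κ W hirr v₀ ι hc hcU hNinf hMinf hMpinf û u v hu hv hcu hvu hbridge _ _ (fun x ↦ ?_) (fun x ↦ ?_) h1 h2
  · rw [pullback_resHomOfEquivariant_apply]
    simp only [AddMonoidHom.coe_comp, Function.comp_apply, AddMonoidHom.id_apply, AddEquiv.coe_toAddMonoidHom, ← map_nsmul, hψp, map_zero]
  · rw [pullback_resHomOfEquivariant_apply, pullback_resHomOfEquivariant_apply]
    simp only [AddMonoidHom.coe_comp, Function.comp_apply, AddMonoidHom.id_apply, AddEquiv.coe_toAddMonoidHom, AddEquiv.apply_symm_apply, hψ']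

end Core

end Summit.BirchSwinnertonDyer.BirchSwinnertonDyer.Theorems.SmallImageCharSignedSelmer

end
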